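import Mathlib.GroupTheory.FreeGroup.GeneratorEquiv
import Literature.GroupTheory.CombinatorialGroupTheory.FreeFactorFiniteIndex
import Literature.AnabelianGeometry.SemiGraphs.FreeGroupsAndActions
import HarnessLib

/-!
# [SemiAnbd] Corollary 1.6 (ii) DISCHARGED: finitely generated subgroups of finite-rank free groups are
# free factors of finite-index subgroups

Mochizuki, *Semi-graphs of anabelioids*, Publ. RIMS **42** (2006), §1, Corollary 1.6 (ii), author's
manuscript p. 19 [cite: MochizukiSemiAnbd2006, Cor. 1.6(ii) p.19] (attributed there to A. Tamagawa; in
the classical literature M. Hall 1949 / Burns 1969, Lyndon–Schupp *Combinatorial Group Theory* Ch. I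
Prop. 3.10): the named fact `Literature.AnabelianGeometry.SemiGraphs.corollary_1_6_ii`
(`FreeGroupsAndActions.lean`) — "there exists a finite index subgroup `H ⊆ G` such that `H` contains `F`,
and, moreover, there exists a set of free generators `γ_1, …, γ_r` of `H` with the property that for some
`s ≤ r`, `γ_1, …, γ_s` form a set of free generators of `F`" — is PROVED here, AS TYPED, from the
free-factor form of M. Hall's theorem
`Literature.GroupTheory.CombinatorialGroupTheory.FreeFactor.exists_finiteIndex_freeFactor` (any free
group, Mathlib `IsFreeGroup`); the finite basis `ι` of `G` makes Mathlib's chosen generators finite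
(`Equiv.ofFreeGroupEquiv`), whence both index types `κ₁`, `κ₂` are finite.

Proof-only companion; the statement file is not modified.
-/

namespace Literature.AnabelianGeometry.SemiGraphs

universe u

/-- **[SemiAnbd] Corollary 1.6 (ii) holds** (A. Tamagawa / M. Hall): the named fact `corollary_1_6_ii` is
a theorem. [cite: MochizukiSemiAnbd2006, Cor. 1.6(ii) p.19] -/
theorem corollary_1_6_ii_holds : corollary_1_6_ii.{u} := by
  intro G _ ι _ bG F hF
  haveI : IsFreeGroup G := bG.isFreeGroup
  haveI : Finite (IsFreeGroup.Generators G) :=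
    Finite.of_equiv ι (Equiv.ofFreeGroupEquiv (bG.repr.symm.trans (IsFreeGroup.toFreeGroup G)))
  obtain ⟨H, hHfi, hFH, κ, s, bH, bF, hfin, hcoe⟩ :=
    Literature.GroupTheory.CombinatorialGroupTheory.FreeFactor.exists_finiteIndex_freeFactor F hF
  haveI : Finite κ := hfin inferInstance
  exact ⟨H, hHfi, hFH, ↥s, ↥sᶜ, inferInstance, inferInstance, bH, bF, hcoe⟩

end Literature.AnabelianGeometry.SemiGraphs
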